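import Summits.ResolutionOfSingularities.KangarooAtlas.MizutaniExtremalTypeHolds
import HarnessLib

/-!
# Mizutani's Thm. 2.8, second part, for ALL `p`, in both vocabularies («the same type as Example 2.1»)

Cell `pub-rosobs`, Mizutani enclosure (seat mizutani-encloser-2, gen 8). AI-written; AI review is weaker than expert review;
NOT a resolution-of-singularities theorem (summit relevance C).

Mizutani (Nagoya Math. J. 52 (1973), Thm. 2.8, p. 90): «Let `e = 1` and `H` be an `H`-scheme `(P_{p^n}, W, V, K)` of exponent `1`, then we
have `min {dim H} = 2p − 1`.  Moreover if `dim H = 2p − 1` and `H` is not a vector group with `V ∩ W = {0}`, then `H` is of the same type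
as Example 2.1» — for `p = 2` «the second part of the theorem is found in [H1] Th. 3» (Hironaka, Ann. of Math. 92 (1970)), for `p` odd it
is Steps (I)–(II) of p. 91–92 with Lemma 2.9.  The tree has the odd case (`span_coords_eq_of_extremal`, encloser-1 g7 composing
encloser-2 g7's `span_coords_eq_of_extremal_of_lemma29` with Lemma 2.9 (2) «⇒») and the case `p = 2` (`exists_type_of_extremal_two`,
encloser-2 g6) in different shapes.  This file states the second part ONCE FOR ALL `p`, in the shape of the odd case — for `p = 2` the
`p`-basis `(c₀', c₁')` is the `p`-independent pair `(y_1, y_2)` itself and both sides are the whole field `k²(y_1, y_2)` (dimension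
`4 = n + 1`; the box monomials `y^W`, `W < 2`, span it) — and in Hironaka's / Mizutani's own vocabulary:

* **`span_coords_eq_of_extremal_all`** — all `p`: a point with no linear form, `(L_B)_1 ≠ 0` and `n + 2 = 2p + dim (L_B)_1` has `n + 1 = 2p`,
  is `[c^{1/p}]` with `c_0 = 1`, `c` `k^p`-independent inside `k^p(y_1, y_2)` (`y ⊆ {c_i}` `p`-independent), and
  `span_{k^p}{c_i} = ⊕_{m<p, j≤1} k^p·c₀'^m c₁'^j = k^p(c₀') ⊕ k^p(c₀')·c₁'` for a `p`-basis `(c₀', c₁')` of `k^p(y_1, y_2)/k^p`;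
* **`span_coords_eq_of_exponent_eq_one`** — the same from `U(𝔭) ∩ L_0 = 0`, `exponent B_{P,𝔭} = 1`, `dim B_{P,𝔭} + 1 = 2p`
  (`ringKrullDim (S ⧸ U_+(𝔭)S) + 1 = 2p`), with the extra conclusion `dim_k (U(𝔭) ∩ L)_1 = 1`.

## References

* H. Mizutani, *Hironaka's additive group schemes*, Nagoya Math. J. 52 (1973) 85–95, Thm. 2.8 (second part), proof p. 91–92, Lemma 2.9 (2).
  [Mizutani1973HironakaGroupSchemes]
* H. Hironaka, *Additive groups associated with points of a projective space*, Ann. of Math. 92 (1970) 327–334, Th. 3 (cited by Mizutani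
  for `p = 2`; proved in the tree, `MizutaniExtremalTwo.lean`). [Hironaka1970AdditiveGroups]
-/

noncomputable section

open MvPolynomial TensorProduct Literature.AlgebraicGeometry.Resolution
  Literature.AlgebraicGeometry.Resolution.HironakaScheme

namespace Summit.ResolutionOfSingularities.KangarooAtlas.Mizutani

universe u

section TypeAll

variable (k : Type u) [Field k] (p : ℕ) [hp : Fact p.Prime] [CharP k p] {n : ℕ}
  (𝔭 : Ideal (MvPolynomial (Fin (n + 1)) k))

/-- **THM. 2.8, SECOND PART, ALL `p` («the closed point corresponding to the generic point has the same type as Example 2.1»).**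
Let `𝔭` be a point of `ℙ^n_k` through which no linear form passes (`(L_B)_0 = 0`), whose Hironaka scheme is not a vector group at level one
(`(L_B)_1 ≠ 0`) and has `dim B(𝔭) + 1 = 2p` read at level one (`n + 2 = 2p + dim (L_B)_1`).  Then `n + 1 = 2p`, `𝔭 = [1^{1/p} : c_1^{1/p} : ⋯ :
c_{2p−1}^{1/p}]` with `k^p`-independent `c_i` lying in the field `k^p(y_1, y_2)` of degree `p²` (`y ⊆ {c_i}` `p`-independent), and for some
`p`-basis `(c₀', c₁')` of `k^p(y_1, y_2)` over `k^p` (a root-tower presentation)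
**`span_{k^p}{c_0, …, c_{2p−1}} = ⊕_{m<p, j≤1} k^p·c₀'^m c₁'^j = k^p(c₀') ⊕ k^p(c₀')·c₁'`** — the span of the coefficients of Example 2.1
(`f = Σ_{m<p} c₁^m X_m + c₂ Σ_{m<p} c₁^m Z_m`).  For `p = 2`: `(c₀', c₁') = (y_1, y_2)` and both sides are all of `k²(y_1, y_2)` (Mizutani cites
Hironaka, Ann. of Math. 92 (1970) Th. 3; here `exists_pair_of_extremal` + dimension count); for `p` odd: `span_coords_eq_of_extremal` (Lemma 2.9).
[cite: Mizutani1973HironakaGroupSchemes, Thm. 2.8 (second part), proof Steps (I)–(II) (p. 91–92), Lemma 2.9 (2); Hironaka1970AdditiveGroups, Th. 3 (p = 2)] -/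
theorem span_coords_eq_of_extremal_all (hP : IsPoint k 𝔭) (h0 : invForms k p 𝔭 0 = ⊥) (hV : invForms k p 𝔭 1 ≠ ⊥)
    (hdim : n + 2 = 2 * p + Module.finrank k (invForms k p 𝔭 1)) :
    n + 1 = 2 * p ∧ ∃ (c : Fin (n + 1) → k) (y : Fin 2 → k) (_ : PIndep p 1 y) (hc : ∀ i, c i ∈ towerField 1 y)
      (x' : Fin 2 → frobPow k p 1) (c' : Fin 2 → towerField 1 y)
      (_ : IsRootTower (frobPow k p 1) (towerField 1 y) (p ^ 1) x' c'),
      c 0 = 1 ∧ LinearIndependent (frobPow k p 1) c ∧ 𝔭 = ratPoint k p 1 c ∧ Set.range y ⊆ Set.range c ∧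
      Submodule.span (frobPow k p 1) (Set.range fun i => (⟨c i, hc i⟩ : towerField 1 y)) =
        Submodule.span (frobPow k p 1) (Set.range fun mj : Fin p × Fin 2 => c' 0 ^ (mj.1 : ℕ) * c' 1 ^ (mj.2 : ℕ)) := by
  classical
  by_cases hp2 : p = 2
  swap
  · exact span_coords_eq_of_extremal k p 𝔭 hp2 hP h0 hV hdim
  -- `p = 2`: the pair `y` itself is the `p`-basis, and both spans are the whole field `k²(y_1, y_2)` (dimension `4 = n + 1`)
  obtain ⟨hn, c, y, hc0, hcind, heq, hy, hyc, hcy⟩ := exists_pair_of_extremal k p 𝔭 hP h0 hV hdim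
  have hc : ∀ i, c i ∈ towerField 1 y := fun i => hcy ⟨i, rfl⟩
  refine ⟨hn, c, y, hy, hc, towerPow 1 y, towerGen 1 y, isRootTower_adjoin hy, hc0, hcind, heq, hyc, ?_⟩
  haveI : FiniteDimensional (frobPow k p 1) (towerField 1 y) :=
    Module.finite_of_finrank_pos (by rw [finrank_adjoin_eq hy]; exact pow_pos (pow_pos hp.out.pos 1) 2)
  -- the left-hand side is everything, by dimension
  have hcind' : LinearIndependent (frobPow k p 1) (fun i => (⟨c i, hc i⟩ : towerField 1 y)) :=
    LinearIndependent.of_comp ((towerField 1 y).val.toLinearMap.restrictScalars (frobPow k p 1)) (by exact hcind)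
  have hL : Submodule.span (frobPow k p 1) (Set.range fun i => (⟨c i, hc i⟩ : towerField 1 y)) = ⊤ := by
    refine Submodule.eq_top_of_finrank_eq ?_
    rw [finrank_span_eq_card hcind', Fintype.card_fin, finrank_adjoin_eq hy, hn, hp2]
    norm_num
  -- the right-hand side is everything: it contains the box monomials `y^W`, `W < 2`
  have hR : Submodule.span (frobPow k p 1)
      (Set.range fun mj : Fin p × Fin 2 => towerGen 1 y 0 ^ (mj.1 : ℕ) * towerGen 1 y 1 ^ (mj.2 : ℕ)) = ⊤ := by
    refine eq_top_iff.mpr fun z _ => ?_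
    have hz := (isRootTower_adjoin hy).mem_span z
    refine Submodule.span_mono ?_ hz
    rintro _ ⟨W, hW, rfl⟩
    have hW0 : W 0 < p := by have := hW 0; rwa [pow_one] at this
    have hW1 : W 1 < 2 := by have := hW 1; rwa [hp2, pow_one] at this
    refine ⟨(⟨W 0, hW0⟩, ⟨W 1, hW1⟩), ?_⟩
    simp only [Fin.prod_univ_two]
  rw [hL, hR]

/-- **THM. 2.8, SECOND PART, ALL `p`, in Hironaka's / Mizutani's own vocabulary.**  Let `𝔭` be a point of `ℙ^n_k` with no linear form in
`U(𝔭)` (`U(𝔭) ∩ L_0 = 0`, Mizutani's `V ∩ W = {0}`), whose scheme `B_{P,𝔭} = Spec S/U_+(𝔭)S` has exponent `1` (not a vector group, Rem. 1.2)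
and `dim B_{P,𝔭} + 1 = 2p` (the minimum `m(1)`, Remark 2.10).  Then `n + 1 = 2p`, `dim_k (U(𝔭) ∩ L)_1 = 1`, `𝔭 = [c^{1/p}]` with `c_0 = 1` and
`k^p`-independent `c_i ∈ k^p(y_1, y_2)` (`y ⊆ {c_i}` `p`-independent), and `span_{k^p}{c_i} = ⊕_{m<p, j≤1} k^p·c₀'^m c₁'^j` for a `p`-basis
`(c₀', c₁')` of `k^p(y_1, y_2)/k^p` — «the same type as Example 2.1».
[cite: Mizutani1973HironakaGroupSchemes, Thm. 2.8 (second part); Lemma 2.9 (2); Hironaka1970AdditiveGroups, Th. 3 (p = 2)] -/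
theorem span_coords_eq_of_exponent_eq_one [𝔭.IsPrime] (hP : IsPoint k 𝔭) (hlin : hirForms k p 𝔭 0 = ⊥)
    (hexp : exponent k p 𝔭 = 1)
    (hdim : ringKrullDim (MvPolynomial (Fin (n + 1)) k ⧸ bIdeal k 𝔭) + 1 = (2 * p : WithBot ℕ∞)) :
    n + 1 = 2 * p ∧ Module.finrank k (hirForms k p 𝔭 1) = 1 ∧
      ∃ (c : Fin (n + 1) → k) (y : Fin 2 → k) (_ : PIndep p 1 y) (hc : ∀ i, c i ∈ towerField 1 y)
        (x' : Fin 2 → frobPow k p 1) (c' : Fin 2 → towerField 1 y)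
        (_ : IsRootTower (frobPow k p 1) (towerField 1 y) (p ^ 1) x' c'),
        c 0 = 1 ∧ LinearIndependent (frobPow k p 1) c ∧ 𝔭 = ratPoint k p 1 c ∧ Set.range y ⊆ Set.range c ∧
        Submodule.span (frobPow k p 1) (Set.range fun i => (⟨c i, hc i⟩ : towerField 1 y)) =
          Submodule.span (frobPow k p 1) (Set.range fun mj : Fin p × Fin 2 => c' 0 ^ (mj.1 : ℕ) * c' 1 ^ (mj.2 : ℕ)) := by
  have h0 : invForms k p 𝔭 0 = ⊥ := by rw [← hirForms_eq_invForms 𝔭 0]; exact hlin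
  have hV := invForms_one_ne_bot_of_exponent_eq_one k p 𝔭 hexp h0
  have hE1 : ExponentLE k p 𝔭 1 := ((exponent_eq_iff k p 𝔭).mp hexp).1
  rw [ringKrullDim_quotient_bIdeal_eq_hsDim_holds k p 𝔭 hP, ← hsDimAt_eq_hsDim k p 𝔭 hE1] at hdim
  have h1 : hsDimAt k p 𝔭 1 + 1 = 2 * p := by exact_mod_cast hdim
  unfold hsDimAt at h1
  have hfin := finrank_invForms_le k p 𝔭 1
  have hdim' : n + 2 = 2 * p + Module.finrank k (invForms k p 𝔭 1) := by omega
  obtain ⟨hn, c, y, hy, hc, x', c', h', hc0, hcind, heq, hyc, hspan⟩ := span_coords_eq_of_extremal_all k p 𝔭 hP h0 hV hdim'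
  refine ⟨hn, ?_, c, y, hy, hc, x', c', h', hc0, hcind, heq, hyc, hspan⟩
  rw [hirForms_eq_invForms 𝔭 1]
  exact (card_eq_of_extremal k p 𝔭 hP h0 hV hdim').2

end TypeAll

end Summit.ResolutionOfSingularities.KangarooAtlas.Mizutani

end
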